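import Literature.Analysis.FunctionSpaces.KantorovichLogDistance
import Literature.Analysis.FunctionSpaces.TorusRademacher
import Literature.Analysis.FunctionSpaces.LadyzhenskayaTorus
import Literature.Analysis.FunctionSpaces.TorusTrigPoly
import Literature.Analysis.SingularIntegrals.TorusMaximalTwoPointInequality
import Literature.Analysis.FluidPDE.StatisticalSolutionEnergyEq
import Mathlib.MeasureTheory.Integral.MeanInequalities
import Mathlib.MeasureTheory.Function.L2Space
import HarnessLib

/-!
# The transport inequality for optimal Kantorovich potentials (Seis 2022, Lemma 3, advective part)

Analysis/FluidPDE support file (everything proved). It serves the discharge of the named facts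
`Literature.Analysis.FluidPDE.Seis2022_rmk1_L2` / `Seis2022_thm2_L2` (`SeisDissipationRateBound`).

Seis 2022, Lemma 3 ([OSS13, Seis18]) bounds the rate of change of the logarithmic Kantorovich
distance `D_δ(θ)` along the advection–diffusion equation by
`‖∇u‖_{L^p} ‖θ‖_{L^{p'}} + (κ/δ)‖∇θ‖_{L¹}`. Its advective part rests on the estimate (with an
optimal plan `π` and an optimal potential `ζ`, `∇ζ(x) = ∇ₓ c_δ(x,y)` on `supp π`)
`∫ θ u·∇ζ = ∫∫ (u(x) - u(y))·∇ₓc_δ dπ ≲ ∫∫ |u(x)-u(y)|/|x-y| dπ ≲ ∫ (θ⁺+θ⁻) M|∇u|`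
(Crippa–De Lellis). This file proves the resulting inequality **directly for the dual
distance** `Torus.krLogDist` of `KantorovichLogDistance`, with no optimal transport:

* `integral_mul_inner_gradient_le_of_twoPoint` — for mean-zero `ρ ∈ L²(T^d)`, an
  **optimal** log-Lipschitz potential `ζ` (`∫ ρ ζ = krLogDist δ ρ`), a `C¹` field `v` and any
  `Ψ` with `‖v x - v y‖ ≤ dist(x,y)(Ψ x + Ψ y)`: `∫ ρ ⟪∇ζ, v⟫ ≤ ∫ |ρ| Ψ`.
  *Proof.* Perturb the potential along the field, `ζ_h = ζ ∘ (id + h v)`: by concavity of the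
  cost (`logCost_le_logCost_add_div`) `ζ_h x - ζ_h y ≤ c_δ(x,y) + h Ψ x + h Ψ y`, so the envelope
  lemma (`integral_mul_le_krLogDist_add`) and optimality give `∫ ρ (ζ_h - ζ)/h ≤ ∫ |ρ| Ψ`;
  as `h → 0` the left side tends to `∫ ρ ⟪∇ζ, v⟫` (Rademacher on `T^d`,
  `Torus.tendsto_div_of_differentiableAt`, dominated convergence with the Lipschitz bound).
* `integral_mul_inner_gradient_le_of_isSmooth` — with the two-point maximal inequality
  (`Torus.exists_twoPoint_maximal`) and Cauchy–Schwarz: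
  `∫ ρ ⟪∇ζ, v⟫ ≤ ‖ρ‖_{L²} (C_d · d · eGradNormSq v)^{1/2}` for smooth `v`.

* `integral_mul_inner_gradient_le_of_eGradNormSq` — the same for every `u ∈ L²(T^d; ℝ^d)`
  with finite spectral enstrophy `eGradNormSq u` (Fourier truncation `P_N u`, which is smooth,
  does not increase the enstrophy and converges in `L²`).

## References

* C. Seis, Comm. Math. Phys. 399 (2023) = arXiv:2003.08794, §2.2, Lemma 3 and the proof of
  Thm. 2. [`Seis2022`]
* F. Otto, C. Seis, D. Slepčev, Comm. Math. Sci. 11 (2013), 441–464 (Lemma 3's source);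
  G. Crippa, C. De Lellis, J. reine angew. Math. 616 (2008), Lemma A.3.
-/

noncomputable section

open MeasureTheory Set Filter Metric Function Topology
open scoped ENNReal NNReal Topology InnerProductSpace
open Literature.Analysis.FunctionSpaces Literature.Analysis.FunctionSpaces.Torus
open Literature.Analysis.SingularIntegrals Literature.Analysis.SingularIntegrals.Torus

namespace Literature.Analysis.FluidPDE

variable {d : Type*} [Fintype d]

/-! ## Perturbing a potential along a vector field -/

/-- The perturbed potential `ζ_h = ζ ∘ (id + h v)`. [folklore] -/
def perturb (ζ : UnitAddTorus d → ℝ) (v : UnitAddTorus d → EuclideanSpace ℝ d) (h : ℝ)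
    (x : UnitAddTorus d) : ℝ :=
  ζ (x + proj (h • v x))

/-- **Two-point defect of the perturbed potential.** If `ζ` is log-Lipschitz and
`‖v x - v y‖ ≤ dist(x,y)(Ψ x + Ψ y)`, then for `h ≥ 0`
`ζ_h x - ζ_h y ≤ c_δ(x,y) + h Ψ x + h Ψ y` (concavity increment of the cost: the points move
apart by at most `h dist(x,y)(Ψ x + Ψ y)`, and `dist/(δ + dist) ≤ 1`). [folklore] -/
theorem perturb_sub_perturb_le {δ : ℝ} (hδ : 0 < δ) {ζ : UnitAddTorus d → ℝ} (hζ : IsLogLipschitz δ ζ)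
    {v : UnitAddTorus d → EuclideanSpace ℝ d} {Ψ : UnitAddTorus d → ℝ} (hΨ0 : ∀ x, 0 ≤ Ψ x)
    (hΨ : ∀ x y, ‖v x - v y‖ ≤ dist x y * (Ψ x + Ψ y)) {h : ℝ} (hh : 0 ≤ h) (x y : UnitAddTorus d) :
    perturb ζ v h x - perturb ζ v h y ≤ logCost δ x y + h * Ψ x + h * Ψ y := by
  unfold perturb
  set s := h * (dist x y * (Ψ x + Ψ y)) with hs
  have hs0 : 0 ≤ s := mul_nonneg hh (mul_nonneg dist_nonneg (add_nonneg (hΨ0 x) (hΨ0 y)))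
  have hmove : dist (x + proj (h • v x)) (y + proj (h • v y)) ≤ dist x y + s := by
    refine (dist_add_add_le _ _ _ _).trans (add_le_add le_rfl ?_)
    rw [dist_eq_norm, ← proj_sub, ← smul_sub]
    refine (norm_proj_le _).trans ?_
    rw [norm_smul, Real.norm_eq_abs, abs_of_nonneg hh]
    exact mul_le_mul_of_nonneg_left (hΨ x y) hh
  have h1 := hζ (x + proj (h • v x)) (y + proj (h • v y))
  have h2 := logCost_le_logCost_add_div hδ hs0 hmove
  have h3 : s / (δ + dist x y) ≤ h * Ψ x + h * Ψ y := by
    rw [div_le_iff₀ (by positivity), hs]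
    have : h * (dist x y * (Ψ x + Ψ y)) ≤ h * ((δ + dist x y) * (Ψ x + Ψ y)) := by
      refine mul_le_mul_of_nonneg_left (mul_le_mul_of_nonneg_right (by linarith) ?_) hh
      linarith [hΨ0 x, hΨ0 y]
    linarith
  linarith

/-- The perturbed potential of a continuous potential along a continuous field is continuous. [folklore] -/
theorem continuous_perturb {ζ : UnitAddTorus d → ℝ} (hζ : Continuous ζ)
    {v : UnitAddTorus d → EuclideanSpace ℝ d} (hv : Continuous v) (h : ℝ) :
    Continuous (perturb ζ v h) :=
  hζ.comp (continuous_id.add (continuous_proj.comp (hv.const_smul h)))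

/-- Lipschitz bound on the perturbation: `|ζ_h x - ζ x| ≤ K h ‖v x‖`. [folklore] -/
theorem abs_perturb_sub_le {K : NNReal} {ζ : UnitAddTorus d → ℝ} (hζ : LipschitzWith K ζ)
    (v : UnitAddTorus d → EuclideanSpace ℝ d) {h : ℝ} (hh : 0 ≤ h) (x : UnitAddTorus d) :
    |perturb ζ v h x - ζ x| ≤ K * (h * ‖v x‖) := by
  unfold perturb
  rw [← Real.dist_eq]
  refine (hζ.dist_le_mul _ _).trans (mul_le_mul_of_nonneg_left ?_ K.2)
  rw [dist_eq_norm, add_sub_cancel_left]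
  refine (norm_proj_le _).trans ?_
  rw [norm_smul, Real.norm_eq_abs, abs_of_nonneg hh]

/-! ## The transport inequality -/

/-- **The transport inequality for an optimal potential, two-point form.** Let `δ > 0`,
`ρ ∈ L²(T^d)` mean-zero, `ζ` an optimal log-Lipschitz potential (`∫ ρ ζ = krLogDist δ ρ`),
`v` a continuous field and `Ψ ≥ 0` with `‖v x - v y‖ ≤ dist(x,y)(Ψ x + Ψ y)` and
`|ρ| Ψ ∈ L¹`. Then `∫ ρ ⟪∇ζ, v⟫ ≤ ∫ |ρ| Ψ` (the advective part of Seis 2022, Lemma 3, in dual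
form: perturb `ζ` along `v`, envelope lemma, optimality, Rademacher and dominated convergence).
[cite: Seis2022, Lemma 3 (advective part), proof of Thm 2 §2.2] -/
theorem integral_mul_inner_gradient_le_of_twoPoint {δ : ℝ} (hδ : 0 < δ) {ρ : UnitAddTorus d → ℝ}
    (hρ : MemLp ρ 2 volume) (h0 : ∫ x, ρ x = 0) {ζ : UnitAddTorus d → ℝ} (hζ : IsLogLipschitz δ ζ)
    (hopt : ∫ x, ρ x * ζ x = krLogDist δ ρ) {v : UnitAddTorus d → EuclideanSpace ℝ d}
    (hv : Continuous v) {Ψ : UnitAddTorus d → ℝ} (hΨ0 : ∀ x, 0 ≤ Ψ x)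
    (hΨ : ∀ x y, ‖v x - v y‖ ≤ dist x y * (Ψ x + Ψ y))
    (hρΨ : Integrable (fun x => |ρ x| * Ψ x) volume) :
    ∫ x, ρ x * ⟪Torus.gradient ζ x, v x⟫_ℝ ≤ ∫ x, |ρ x| * Ψ x := by
  have hρi : Integrable ρ volume := hρ.integrable one_le_two
  have hζL := hζ.lipschitzWith hδ
  have hζc : Continuous ζ := hζ.continuous hδ
  set K : NNReal := Real.toNNReal δ⁻¹ with hK
  obtain ⟨Cv, hCv⟩ := exists_forall_norm_le_of_continuous hv
  obtain ⟨Cζ, hCζ⟩ := exists_forall_norm_le_of_continuous hζc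
  -- Step 1: for every `h > 0`, `∫ ρ (ζ_h - ζ) ≤ h ∫ |ρ| Ψ`
  have hstep : ∀ {h : ℝ}, 0 < h → ∫ x, ρ x * ((perturb ζ v h x - ζ x) / h) ≤ ∫ x, |ρ x| * Ψ x := by
    intro h hh
    have hpc : Continuous (perturb ζ v h) := continuous_perturb hζc hv h
    have hpi : Integrable (fun x => ρ x * perturb ζ v h x) volume :=
      hρi.mul_bdd hpc.aestronglyMeasurable (Eventually.of_forall fun x => hCζ _)
    have hΦi : Integrable (fun x => |ρ x| * (h * Ψ x)) volume := by
      have : (fun x => |ρ x| * (h * Ψ x)) = fun x => h * (|ρ x| * Ψ x) := by funext x; ring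
      rw [this]; exact hρΨ.const_mul h
    have henv := integral_mul_le_krLogDist_add hδ hρi h0 (G := univ) (Eventually.of_forall mem_univ)
      (fun x _ y _ => perturb_sub_perturb_le hδ hζ hΨ0 hΨ hh.le x y) hpi hΦi
    rw [← hopt] at henv
    have hζi : Integrable (fun x => ρ x * ζ x) volume := hζ.integrable_mul hδ hρi
    have e1 : ∫ x, ρ x * ((perturb ζ v h x - ζ x) / h) =
        h⁻¹ * ((∫ x, ρ x * perturb ζ v h x) - ∫ x, ρ x * ζ x) := by
      rw [← integral_sub hpi hζi, ← integral_const_mul]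
      refine integral_congr_ae (Eventually.of_forall fun x => ?_)
      show ρ x * ((perturb ζ v h x - ζ x) / h) = h⁻¹ * (ρ x * perturb ζ v h x - ρ x * ζ x)
      field_simp
    have e2 : ∫ x, |ρ x| * (h * Ψ x) = h * ∫ x, |ρ x| * Ψ x := by
      rw [← integral_const_mul]
      refine integral_congr_ae (Eventually.of_forall fun x => ?_)
      show |ρ x| * (h * Ψ x) = h * (|ρ x| * Ψ x)
      ring
    rw [e2] at henv
    rw [e1, inv_mul_le_iff₀ hh]
    linarith
  -- Step 2: pass to the limit `h = 1/(n+1) → 0`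
  set hs : ℕ → ℝ := fun n => 1 / ((n : ℝ) + 1) with hhs
  have hpos : ∀ n, 0 < hs n := fun n => by positivity
  have hlim0 : Tendsto hs atTop (𝓝[≠] 0) :=
    tendsto_nhdsWithin_iff.2 ⟨tendsto_one_div_add_atTop_nhds_zero_nat,
      Eventually.of_forall fun n => (hpos n).ne'⟩
  set Fn : ℕ → UnitAddTorus d → ℝ := fun n x => ρ x * ((perturb ζ v (hs n) x - ζ x) / hs n) with hFn
  have hFm : ∀ n, AEStronglyMeasurable (Fn n) volume := fun n =>
    hρ.1.mul (((continuous_perturb hζc hv _).sub hζc).div_const _).aestronglyMeasurable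
  have hbound : ∀ n, ∀ᵐ x ∂(volume : Measure (UnitAddTorus d)), ‖Fn n x‖ ≤ |ρ x| * (K * Cv) := by
    intro n
    refine Eventually.of_forall fun x => ?_
    rw [Real.norm_eq_abs, hFn]
    simp only [abs_mul, abs_div, abs_of_pos (hpos n)]
    refine mul_le_mul_of_nonneg_left ?_ (abs_nonneg _)
    rw [div_le_iff₀ (hpos n)]
    calc |perturb ζ v (hs n) x - ζ x| ≤ K * (hs n * ‖v x‖) := abs_perturb_sub_le hζL v (hpos n).le x
      _ ≤ K * (hs n * Cv) := mul_le_mul_of_nonneg_left (mul_le_mul_of_nonneg_left (hCv x) (hpos n).le) K.2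
      _ = K * Cv * hs n := by ring
  have hbi : Integrable (fun x => |ρ x| * (K * Cv)) volume := hρi.abs.mul_const _
  have hlim : ∀ᵐ x ∂(volume : Measure (UnitAddTorus d)),
      Tendsto (fun n => Fn n x) atTop (𝓝 (ρ x * ⟪Torus.gradient ζ x, v x⟫_ℝ)) := by
    filter_upwards [ae_differentiableAt_liftAt hζL] with x hx
    have ht := (tendsto_div_of_differentiableAt hx (v x)).comp hlim0
    exact (ht.const_mul (ρ x)).congr fun n => rfl
  have hconv := tendsto_integral_of_dominated_convergence _ hFm hbi hbound hlim
  exact le_of_tendsto' hconv fun n => hstep (hpos n)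

/-! ## The `H¹` form for smooth fields -/

/-- Real Cauchy–Schwarz in the form used here: for `ρ ∈ L²` and `0 ≤ Ψ` with `∫ Ψ² ≤ B`
(`Ψ²` integrable), `∫ |ρ| Ψ ≤ √(∫ ρ²) √B`. [folklore] -/
theorem integral_abs_mul_le_sqrt_mul_sqrt {ρ Ψ : UnitAddTorus d → ℝ} (hρ : MemLp ρ 2 volume)
    (hΨm : AEStronglyMeasurable Ψ volume) (hΨ0 : ∀ x, 0 ≤ Ψ x)
    (hΨi : Integrable (fun x => Ψ x ^ 2) volume) {B : ℝ} (hB : ∫ x, Ψ x ^ 2 ≤ B) :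
    ∫ x, |ρ x| * Ψ x ≤ Real.sqrt (∫ x, ρ x ^ 2) * Real.sqrt B := by
  have hΨ2 : MemLp Ψ 2 volume := (memLp_two_iff_integrable_sq hΨm).2 hΨi
  have h := integral_mul_le_Lp_mul_Lq_of_nonneg Real.HolderConjugate.two_two
    (Eventually.of_forall fun x => abs_nonneg (ρ x)) (Eventually.of_forall hΨ0)
    (by rw [ENNReal.ofReal_ofNat]; exact hρ.abs) (by rw [ENNReal.ofReal_ofNat]; exact hΨ2)
  simp only [Real.rpow_two, sq_abs] at h
  rw [← Real.sqrt_eq_rpow, ← Real.sqrt_eq_rpow] at h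
  exact h.trans (mul_le_mul_of_nonneg_left (Real.sqrt_le_sqrt hB) (Real.sqrt_nonneg _))

variable [DecidableEq d]

/-- **The transport inequality, `H¹` form, smooth fields.** For `δ > 0`, mean-zero
`ρ ∈ L²(T^d)`, an optimal log-Lipschitz potential `ζ` and a smooth field `v`:
`∫ ρ ⟪∇ζ, v⟫ ≤ ‖ρ‖_{L²} (C_d · d · eGradNormSq v)^{1/2}` with `C_d = twoPointL2Const d`
(two-point maximal inequality `Torus.exists_twoPoint_maximal` fed into
`integral_mul_inner_gradient_le_of_twoPoint`, Cauchy–Schwarz, and `∫ ‖Dv‖² ≤ d · eGradNormSq v`).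
This is the advective part of Seis 2022, Lemma 3 for `p = p' = 2`.
[cite: Seis2022, Lemma 3 (p = 2), proof of Thm 2 §2.2] -/
theorem integral_mul_inner_gradient_le_of_isSmooth {δ : ℝ} (hδ : 0 < δ) {ρ : UnitAddTorus d → ℝ}
    (hρ : MemLp ρ 2 volume) (h0 : ∫ x, ρ x = 0) {ζ : UnitAddTorus d → ℝ} (hζ : IsLogLipschitz δ ζ)
    (hopt : ∫ x, ρ x * ζ x = krLogDist δ ρ) {v : UnitAddTorus d → EuclideanSpace ℝ d}
    (hv : IsSmooth v) :
    ∫ x, ρ x * ⟪Torus.gradient ζ x, v x⟫_ℝ ≤ Real.sqrt (∫ x, ρ x ^ 2) *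
      Real.sqrt ((twoPointL2Const d).toReal * (Fintype.card d * (eGradNormSq v).toReal)) := by
  obtain ⟨Ψ, hΨm, hΨfin, h2pt, hL2⟩ := exists_twoPoint_maximal (hv.isContDiff (n := 1) (by simp))
  set Ψr : UnitAddTorus d → ℝ := fun x => (Ψ x).toReal with hΨr
  have hΨr0 : ∀ x, 0 ≤ Ψr x := fun x => ENNReal.toReal_nonneg
  have hofReal : ∀ x, ENNReal.ofReal (Ψr x) = Ψ x := fun x => ENNReal.ofReal_toReal (hΨfin x).ne
  -- the real two-point inequality
  have h2r : ∀ x y, ‖v x - v y‖ ≤ dist x y * (Ψr x + Ψr y) := by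
    intro x y
    have h := h2pt x y
    rw [← hofReal x, ← hofReal y, ← ENNReal.ofReal_add (hΨr0 x) (hΨr0 y),
      ← ENNReal.ofReal_mul dist_nonneg, ← ofReal_norm] at h
    exact (ENNReal.ofReal_le_ofReal_iff (by positivity)).1 h
  -- `Ψr ∈ L²` with `∫ Ψr² = (∫⁻ Ψ²).toReal`
  have hΨrm : Measurable Ψr := hΨm.ennreal_toReal
  have hfin : ∫⁻ x, Ψ x ^ 2 < ∞ := by
    refine lt_of_le_of_lt hL2 (ENNReal.mul_lt_top (twoPointL2Const_lt_top d) ?_)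
    exact lt_of_le_of_lt (lintegral_enorm_fderiv_sq_le_card_mul_eGradNormSq hv)
      (ENNReal.mul_lt_top (ENNReal.natCast_lt_top _) (eGradNormSq_lt_top hv))
  have hΨsq : ∀ x, ENNReal.ofReal (Ψr x ^ 2) = Ψ x ^ 2 := fun x => by
    rw [ENNReal.ofReal_pow (hΨr0 x), hofReal]
  have hΨi : Integrable (fun x => Ψr x ^ 2) volume := by
    refine ⟨(hΨrm.pow_const 2).aestronglyMeasurable, ?_⟩
    rw [hasFiniteIntegral_iff_enorm]
    calc ∫⁻ x, ‖Ψr x ^ 2‖ₑ = ∫⁻ x, Ψ x ^ 2 := lintegral_congr fun x => by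
          rw [Real.enorm_eq_ofReal (sq_nonneg _), hΨsq]
      _ < ∞ := hfin
  have hint : ∫ x, Ψr x ^ 2 = (∫⁻ x, Ψ x ^ 2).toReal := by
    rw [integral_eq_lintegral_of_nonneg_ae (Eventually.of_forall fun x => sq_nonneg _)
      (hΨrm.pow_const 2).aestronglyMeasurable]
    congr 1
    exact lintegral_congr fun x => hΨsq x
  have hB : ∫ x, Ψr x ^ 2 ≤ (twoPointL2Const d).toReal * (Fintype.card d * (eGradNormSq v).toReal) := by
    rw [hint]
    have hne : twoPointL2Const d * (Fintype.card d * eGradNormSq v) ≠ ∞ :=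
      (ENNReal.mul_lt_top (twoPointL2Const_lt_top d)
        (ENNReal.mul_lt_top (ENNReal.natCast_lt_top _) (eGradNormSq_lt_top hv))).ne
    have hle : ∫⁻ x, Ψ x ^ 2 ≤ twoPointL2Const d * (Fintype.card d * eGradNormSq v) :=
      hL2.trans (mul_le_mul' le_rfl (lintegral_enorm_fderiv_sq_le_card_mul_eGradNormSq hv))
    have := ENNReal.toReal_mono hne hle
    rwa [ENNReal.toReal_mul, ENNReal.toReal_mul, ENNReal.toReal_natCast] at this
  -- `|ρ| Ψr ∈ L¹`
  have hΨ2 : MemLp Ψr 2 volume := (memLp_two_iff_integrable_sq hΨrm.aestronglyMeasurable).2 hΨi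
  have hρΨ : Integrable (fun x => |ρ x| * Ψr x) volume := by
    have h := memLp_one_iff_integrable.1 (MemLp.mul (r := 1) hΨ2 hρ.abs)
    exact h
  calc ∫ x, ρ x * ⟪Torus.gradient ζ x, v x⟫_ℝ ≤ ∫ x, |ρ x| * Ψr x :=
        integral_mul_inner_gradient_le_of_twoPoint hδ hρ h0 hζ hopt hv.continuous hΨr0 h2r hρΨ
    _ ≤ _ := integral_abs_mul_le_sqrt_mul_sqrt hρ hΨrm.aestronglyMeasurable hΨr0 hΨi hB

/-! ## Rough fields: Fourier truncation -/

/-- `∫ ‖P_N u - u‖² → 0` as a real integral, for `u ∈ L²`. [folklore] -/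
theorem tendsto_integral_norm_fourierTruncate_sub_sq {u : UnitAddTorus d → EuclideanSpace ℝ d}
    (hu : MemLp u 2 volume) :
    Tendsto (fun N => ∫ x, ‖fourierTruncate N u x - u x‖ ^ 2) atTop (𝓝 0) := by
  have h := tendsto_lintegral_enorm_sq_fourierTruncate_sub hu
  have h2 := (ENNReal.tendsto_toReal ENNReal.zero_ne_top).comp h
  rw [ENNReal.toReal_zero] at h2
  refine h2.congr fun N => ?_
  have hm : AEStronglyMeasurable (fun x => fourierTruncate N u x - u x) volume :=
    (continuous_fourierTruncate N u).aestronglyMeasurable.sub hu.1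
  have hm2 : AEStronglyMeasurable (fun x => ‖fourierTruncate N u x - u x‖ ^ 2) volume :=
    (hm.norm.aemeasurable.pow_const 2).aestronglyMeasurable
  rw [Function.comp_apply, integral_eq_lintegral_of_nonneg_ae (Eventually.of_forall fun x => sq_nonneg _) hm2]
  congr 1
  exact lintegral_congr fun x => by rw [ENNReal.ofReal_pow (norm_nonneg _), ofReal_norm]

/-- **The transport inequality, `H¹` form, rough fields (Seis 2022, Lemma 3, advective part,
`p = 2`).** For `δ > 0`, mean-zero `ρ ∈ L²(T^d)`, an optimal log-Lipschitz potential `ζ` and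
`u ∈ L²(T^d; ℝ^d)` with finite spectral enstrophy:
`∫ ρ ⟪∇ζ, u⟫ ≤ ‖ρ‖_{L²} (C_d · d · eGradNormSq u)^{1/2}`, `C_d = twoPointL2Const d`
(smooth case applied to the truncations `P_N u`, `eGradNormSq (P_N u) ≤ eGradNormSq u`,
`P_N u → u` in `L²`). [cite: Seis2022, Lemma 3 (p = 2), proof of Thm 2 §2.2] -/
theorem integral_mul_inner_gradient_le_of_eGradNormSq {δ : ℝ} (hδ : 0 < δ) {ρ : UnitAddTorus d → ℝ}
    (hρ : MemLp ρ 2 volume) (h0 : ∫ x, ρ x = 0) {ζ : UnitAddTorus d → ℝ} (hζ : IsLogLipschitz δ ζ)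
    (hopt : ∫ x, ρ x * ζ x = krLogDist δ ρ) {u : UnitAddTorus d → EuclideanSpace ℝ d}
    (hu : MemLp u 2 volume) (hG : eGradNormSq u ≠ ∞) :
    ∫ x, ρ x * ⟪Torus.gradient ζ x, u x⟫_ℝ ≤ Real.sqrt (∫ x, ρ x ^ 2) *
      Real.sqrt ((twoPointL2Const d).toReal * (Fintype.card d * (eGradNormSq u).toReal)) := by
  have hui : Integrable u volume := hu.integrable one_le_two
  have hρi : Integrable ρ volume := hρ.integrable one_le_two
  have hζL := hζ.lipschitzWith hδ
  set K : NNReal := Real.toNNReal δ⁻¹ with hK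
  set bound : ℝ := Real.sqrt (∫ x, ρ x ^ 2) *
    Real.sqrt ((twoPointL2Const d).toReal * (Fintype.card d * (eGradNormSq u).toReal)) with hbound
  set a : ℕ → ℝ := fun N => ∫ x, ρ x * ⟪Torus.gradient ζ x, fourierTruncate N u x⟫_ℝ with ha
  -- each truncation obeys the bound
  have hN : ∀ N, a N ≤ bound := fun N => by
    have h := integral_mul_inner_gradient_le_of_isSmooth hδ hρ h0 hζ hopt (isSmooth_fourierTruncate N u)
    refine h.trans (mul_le_mul_of_nonneg_left (Real.sqrt_le_sqrt ?_) (Real.sqrt_nonneg _))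
    refine mul_le_mul_of_nonneg_left (mul_le_mul_of_nonneg_left ?_ (Nat.cast_nonneg _))
      ENNReal.toReal_nonneg
    exact ENNReal.toReal_mono hG (Torus.eGradNormSq_fourierTruncate_le hui N)
  -- integrability of the pairings
  have hgradm : Measurable (Torus.gradient ζ) := measurable_gradient ζ
  have hgradb : ∀ x, ‖Torus.gradient ζ x‖ ≤ K := norm_gradient_le_of_lipschitz hζL
  have hpair : ∀ {w : UnitAddTorus d → EuclideanSpace ℝ d}, MemLp w 2 volume →
      Integrable (fun x => ρ x * ⟪Torus.gradient ζ x, w x⟫_ℝ) volume := by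
    intro w hw
    have hprod : Integrable (fun x => (K * |ρ x|) * ‖w x‖) volume :=
      memLp_one_iff_integrable.1 (MemLp.mul (r := 1) hw.norm (hρ.abs.const_mul (K : ℝ)))
    refine hprod.mono' (hρ.1.mul (hgradm.aestronglyMeasurable.inner hw.1)) (Eventually.of_forall fun x => ?_)
    rw [Real.norm_eq_abs, abs_mul]
    calc |ρ x| * |⟪Torus.gradient ζ x, w x⟫_ℝ| ≤ |ρ x| * (‖Torus.gradient ζ x‖ * ‖w x‖) :=
          mul_le_mul_of_nonneg_left (abs_real_inner_le_norm _ _) (abs_nonneg _)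
      _ ≤ |ρ x| * (K * ‖w x‖) :=
          mul_le_mul_of_nonneg_left (mul_le_mul_of_nonneg_right (hgradb x) (norm_nonneg _)) (abs_nonneg _)
      _ = K * |ρ x| * ‖w x‖ := by ring
  -- convergence `a N → ∫ ρ ⟪∇ζ, u⟫`
  have hconv : Tendsto a atTop (𝓝 (∫ x, ρ x * ⟪Torus.gradient ζ x, u x⟫_ℝ)) := by
    have hmemN : ∀ N, MemLp (fourierTruncate N u) 2 volume := fun N => (isSmooth_fourierTruncate N u).memLp 2
    have hdiff : ∀ N, a N - ∫ x, ρ x * ⟪Torus.gradient ζ x, u x⟫_ℝ =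
        ∫ x, ρ x * ⟪Torus.gradient ζ x, fourierTruncate N u x - u x⟫_ℝ := fun N => by
      rw [ha, ← integral_sub (hpair (hmemN N)) (hpair hu)]
      refine integral_congr_ae (Eventually.of_forall fun x => ?_)
      simp only [inner_sub_right, mul_sub]
    have hcs : ∀ N, |a N - ∫ x, ρ x * ⟪Torus.gradient ζ x, u x⟫_ℝ| ≤
        Real.sqrt (∫ x, (K * |ρ x|) ^ 2) * Real.sqrt (∫ x, ‖fourierTruncate N u x - u x‖ ^ 2) := fun N => by
      rw [hdiff N]
      have hw : MemLp (fun x => fourierTruncate N u x - u x) 2 volume := (hmemN N).sub hu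
      have hKρ : MemLp (fun x => K * |ρ x|) 2 volume := hρ.abs.const_mul (K : ℝ)
      have h1 : |∫ x, ρ x * ⟪Torus.gradient ζ x, fourierTruncate N u x - u x⟫_ℝ| ≤
          ∫ x, (K * |ρ x|) * ‖fourierTruncate N u x - u x‖ := by
        refine (abs_integral_le_integral_abs).trans (integral_mono (hpair hw).abs
          (memLp_one_iff_integrable.1 (MemLp.mul (r := 1) hw.norm hKρ)) fun x => ?_)
        show |ρ x * ⟪Torus.gradient ζ x, fourierTruncate N u x - u x⟫_ℝ| ≤ K * |ρ x| * ‖fourierTruncate N u x - u x‖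
        rw [abs_mul]
        calc |ρ x| * |⟪Torus.gradient ζ x, fourierTruncate N u x - u x⟫_ℝ|
            ≤ |ρ x| * (‖Torus.gradient ζ x‖ * ‖fourierTruncate N u x - u x‖) :=
              mul_le_mul_of_nonneg_left (abs_real_inner_le_norm _ _) (abs_nonneg _)
          _ ≤ |ρ x| * (K * ‖fourierTruncate N u x - u x‖) :=
              mul_le_mul_of_nonneg_left (mul_le_mul_of_nonneg_right (hgradb x) (norm_nonneg _)) (abs_nonneg _)
          _ = K * |ρ x| * ‖fourierTruncate N u x - u x‖ := by ring
      have h2 := integral_mul_le_Lp_mul_Lq_of_nonneg Real.HolderConjugate.two_two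
        (f := fun x => (K : ℝ) * |ρ x|) (g := fun x => ‖fourierTruncate N u x - u x‖)
        (Eventually.of_forall fun x => by positivity) (Eventually.of_forall fun x => norm_nonneg _)
        (by rw [ENNReal.ofReal_ofNat]; exact hKρ) (by rw [ENNReal.ofReal_ofNat]; exact hw.norm)
      simp only [Real.rpow_two] at h2
      rw [← Real.sqrt_eq_rpow, ← Real.sqrt_eq_rpow] at h2
      exact h1.trans h2
    have hzero : Tendsto (fun N => Real.sqrt (∫ x, (K * |ρ x|) ^ 2) *
        Real.sqrt (∫ x, ‖fourierTruncate N u x - u x‖ ^ 2)) atTop (𝓝 0) := by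
      have h := (Real.continuous_sqrt.tendsto 0).comp (tendsto_integral_norm_fourierTruncate_sub_sq hu)
      rw [Function.comp_def, Real.sqrt_zero] at h
      simpa using h.const_mul (Real.sqrt (∫ x, (K * |ρ x|) ^ 2))
    have h := squeeze_zero_norm (fun N => by rw [Real.norm_eq_abs]; exact hcs N) hzero
    exact tendsto_sub_nhds_zero_iff.1 h
  exact le_of_tendsto' hconv hN

end Literature.Analysis.FluidPDE
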